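import Mathlib.FieldTheory.IsAlgClosed.AlgebraicClosure
import Mathlib.FieldTheory.Minpoly.Finite
import Mathlib.RingTheory.Valuation.ValuationSubring
import Mathlib.RingTheory.Valuation.Integral
import Mathlib.Data.Nat.Factorization.Basic
import HarnessLib

/-!
# Valuations on fields algebraic over `ℚ`: residue characteristic and `p`-adic discreteness

First half of the generic valuation-theoretic engine behind [AbsTopIII] Remark 1.5.3 (i)
(S. Mochizuki, *Topics in Absolute Anabelian Geometry III*, kurims manuscript p. 33, lit key
`paper:url-5493eb38cbb7`) [cite: MochizukiAbsTopIII2015, Rmk 1.5.3 (i) p.33]: for an algebraic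
extension `k` of a number field carrying a nonarchimedean prime `𝔭` UNRAMIFIED over a number field
inside `k` (and with all `μ(k†)` finite), "`⋂_N (k^×)^N = {1}`".  What the printed `p`-adic
argument uses about the completion `k_𝔭` is, first of all, that its valuation is DISCRETE; this
file isolates that input for an ABSTRACT valued field `(K, v : Valuation K Γ₀)` in the weak form
`v(x)^D ∈ v(p)^ℤ` ("weak discreteness with exponent `D`"), which is what the contraction argument of
the sequel `DiscreteValuationDivisibleUnits.lean` consumes, and which — unlike a uniformiser —
climbs finite extensions for free.

## Contents (Mathlib-only; no definitions, no named facts)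

* `valueGroup_*`: elementary ordered toolkit for powers of an element `0 ≠ a < 1` of a linearly
  ordered commutative group with zero (strict anti-monotonicity and injectivity of `n ↦ aⁿ` on
  `ℤ`, torsion-freeness), and `eq_zero_of_forall_valuation_pow_le`.
* `natCast_mem_valuationInteger`, `intCast_mem_valuationInteger`: integers lie in the valuation ring.
* `exists_prime_valuation_lt_one`: a nontrivial valuation on a field algebraic over `ℚ` has a
  residue characteristic, `v(p) < 1` for some prime `p`.
* `valuation_natCast_eq_one_of_not_dvd`, `exists_valuation_ratCast_eq_zpow`: then `v` is `p`-adic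
  on `ℚ`, `v(q) ∈ v(p)^ℤ` for `q ∈ ℚ^×` (Bezout) — the value group of `ℚ` is discrete.
* `exists_pow_valuation_eq_of_aeval_eq_zero`,
  `exists_valuation_pow_mul_eq_zpow_of_finiteDimensional`: the ultrametric degree bound — a root
  `x` of a nonzero `P ∈ K[X]` has `v(x)^r ∈ v(K^×)` for some `1 ≤ r ≤ deg P` (two terms of
  `P(x) = 0` share the maximal valuation); hence weak discreteness climbs finite extensions with
  `D ↦ [L:K]! · D` ("any finite extension of `k` satisfies the same hypotheses as `k`").
-/

noncomputable section

open scoped Classical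
open Polynomial

namespace Literature.NumberTheory.GaloisRepresentations

variable {K : Type*} [Field K] {Γ₀ : Type*} [LinearOrderedCommGroupWithZero Γ₀]
  (v : Valuation K Γ₀)

/-! ### Ordered toolkit for the value group: powers of an element `0 ≠ a < 1` -/

section Toolkit

/-- `a ↦ a ^ i` is monotone. [cite: MochizukiAbsTopIII2015, Rmk 1.5.3 (i) p.33] -/
theorem valueGroup_pow_le_pow_left {a b : Γ₀} (h : a ≤ b) : ∀ i : ℕ, a ^ i ≤ b ^ i
  | 0 => by rw [pow_zero, pow_zero]
  | i + 1 => by rw [pow_succ, pow_succ]; exact mul_le_mul' (valueGroup_pow_le_pow_left h i) h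

/-- `a ≤ 1 ⟹ a ^ i ≤ 1`. [cite: MochizukiAbsTopIII2015, Rmk 1.5.3 (i) p.33] -/
theorem valueGroup_pow_le_one {a : Γ₀} (h : a ≤ 1) (i : ℕ) : a ^ i ≤ 1 := by
  simpa only [one_pow] using valueGroup_pow_le_pow_left h i

/-- `a < 1 ⟹ a ^ D < 1` for `D > 0`. [cite: MochizukiAbsTopIII2015, Rmk 1.5.3 (i) p.33] -/
theorem valueGroup_pow_lt_one {a : Γ₀} (ha : a < 1) {D : ℕ} (hD : 0 < D) : a ^ D < 1 := by
  obtain ⟨k, rfl⟩ : ∃ k, D = k + 1 := ⟨D - 1, by omega⟩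
  rw [pow_succ]
  calc a ^ k * a ≤ 1 * a := mul_le_mul_left (valueGroup_pow_le_one ha.le k) a
    _ = a := one_mul a
    _ < 1 := ha

/-- `1 < a ⟹ 1 < a ^ (k+1)`. [cite: MochizukiAbsTopIII2015, Rmk 1.5.3 (i) p.33] -/
theorem valueGroup_one_lt_pow_succ {a : Γ₀} (ha : 1 < a) (k : ℕ) : 1 < a ^ (k + 1) := by
  induction k with
  | zero => rwa [zero_add, pow_one]
  | succ k ih =>
    rw [pow_succ]
    calc (1 : Γ₀) < a := ha
      _ = 1 * a := (one_mul a).symm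
      _ ≤ a ^ (k + 1) * a := mul_le_mul_left ih.le a

/-- `a ^ n = 1` with `n > 0` forces `a = 1` (the value group is torsion-free).
[cite: MochizukiAbsTopIII2015, Rmk 1.5.3 (i) p.33] -/
theorem valueGroup_eq_one_of_pow_eq_one {a : Γ₀} {n : ℕ} (hn : 0 < n) (h : a ^ n = 1) : a = 1 := by
  obtain ⟨k, rfl⟩ : ∃ k, n = k + 1 := ⟨n - 1, by omega⟩
  rcases lt_trichotomy a 1 with ha | ha | ha
  · exact absurd h (valueGroup_pow_lt_one ha k.succ_pos).ne
  · exact ha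
  · exact absurd h (valueGroup_one_lt_pow_succ ha k).ne'

/-- `n ↦ a ^ n` (`n : ℤ`) is strictly decreasing for `0 ≠ a < 1`.
[cite: MochizukiAbsTopIII2015, Rmk 1.5.3 (i) p.33] -/
theorem valueGroup_zpow_lt_zpow_of_lt {a : Γ₀} (ha0 : a ≠ 0) (ha1 : a < 1) {m n : ℤ} (h : m < n) :
    a ^ n < a ^ m := by
  have hn : n = m + (((n - m - 1).toNat + 1 : ℕ) : ℤ) := by
    have := Int.toNat_of_nonneg (show 0 ≤ n - m - 1 by omega)
    push_cast
    omega
  rw [hn, zpow_add₀ ha0, zpow_natCast]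
  have hlt : a ^ ((n - m - 1).toNat + 1) < 1 := valueGroup_pow_lt_one ha1 (Nat.succ_pos _)
  calc a ^ m * a ^ ((n - m - 1).toNat + 1) < a ^ m * 1 :=
        lt_of_le_of_ne (mul_le_mul_right hlt.le _)
          fun heq => hlt.ne (mul_left_cancel₀ (zpow_ne_zero m ha0) heq)
    _ = a ^ m := mul_one _

/-- Contrapositive monotonicity: `a ^ m ≤ a ^ n ⟹ n ≤ m` for `0 ≠ a < 1`.
[cite: MochizukiAbsTopIII2015, Rmk 1.5.3 (i) p.33] -/
theorem valueGroup_le_of_zpow_le_zpow {a : Γ₀} (ha0 : a ≠ 0) (ha1 : a < 1) {m n : ℤ}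
    (h : a ^ m ≤ a ^ n) : n ≤ m :=
  not_lt.mp fun hlt => (not_le.mpr (valueGroup_zpow_lt_zpow_of_lt ha0 ha1 hlt)) h

/-- `n ↦ a ^ n` (`n : ℤ`) is injective for `0 ≠ a < 1`.
[cite: MochizukiAbsTopIII2015, Rmk 1.5.3 (i) p.33] -/
theorem valueGroup_zpow_injective {a : Γ₀} (ha0 : a ≠ 0) (ha1 : a < 1) {m n : ℤ}
    (h : a ^ m = a ^ n) : m = n :=
  le_antisymm (valueGroup_le_of_zpow_le_zpow ha0 ha1 h.ge) (valueGroup_le_of_zpow_le_zpow ha0 ha1 h.le)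

/-- A power `a ^ n < 1` (`n : ℤ`) of `0 ≠ a < 1` is already `≤ a`: the largest value below `1`
in `a^ℤ` is `a`. [cite: MochizukiAbsTopIII2015, Rmk 1.5.3 (i) p.33] -/
theorem valueGroup_zpow_le_self_of_zpow_lt_one {a : Γ₀} (ha0 : a ≠ 0) (ha1 : a < 1) {n : ℤ}
    (h : a ^ n < 1) : a ^ n ≤ a := by
  have h1 : (1 : ℤ) ≤ n := by
    by_contra hlt
    have hn0 : n ≤ 0 := by omega
    have h0 : a ^ (0 : ℤ) ≤ a ^ n := by
      rcases eq_or_lt_of_le hn0 with h0 | h0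
      · rw [h0]
      · exact (valueGroup_zpow_lt_zpow_of_lt ha0 ha1 h0).le
    rw [zpow_zero] at h0
    exact (not_lt.mpr h0) h
  rcases eq_or_lt_of_le h1 with h2 | h2
  · rw [← h2, zpow_one]
  · calc a ^ n ≤ a ^ (1 : ℤ) := (valueGroup_zpow_lt_zpow_of_lt ha0 ha1 h2).le
      _ = a := zpow_one a

end Toolkit

/-- Under WEAK DISCRETENESS at `y` (`v(y)^D ∈ a^ℤ`), the bounds `v(y)^D ≤ aⁿ` for all `n` force
`y = 0` (the exponent would exceed every `n`). [cite: MochizukiAbsTopIII2015, Rmk 1.5.3 (i) p.33] -/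
theorem eq_zero_of_forall_valuation_pow_le {a : Γ₀} (ha0 : a ≠ 0) (ha1 : a < 1) {D : ℕ} {y : K}
    (hdisc : y ≠ 0 → ∃ k : ℤ, v y ^ D = a ^ k) (h : ∀ n : ℕ, v y ^ D ≤ a ^ n) : y = 0 := by
  by_contra hy
  obtain ⟨k, hk⟩ := hdisc hy
  have h1 := h (k.toNat + 1)
  rw [hk, ← zpow_natCast] at h1
  have h2 := valueGroup_le_of_zpow_le_zpow ha0 ha1 h1
  have h3 := Int.self_le_toNat k
  push_cast at h2
  omega

/-! ### Integers and rationals under a valuation -/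

/-- Natural numbers lie in every valuation ring (`v(n) ≤ 1`, ultrametric inequality) — first
step of the `p`-adic argument of [AbsTopIII] Rmk. 1.5.3 (i).
[cite: MochizukiAbsTopIII2015, Rmk 1.5.3 (i) p.33] -/
theorem natCast_mem_valuationInteger (n : ℕ) : (n : K) ∈ v.integer := by
  rw [Valuation.mem_integer_iff]
  induction n with
  | zero => simp
  | succ n ih =>
    rw [Nat.cast_succ]
    exact (v.map_add _ _).trans (max_le ih (le_of_eq v.map_one))

/-- Integers lie in every valuation ring (`v(z) ≤ 1`).
[cite: MochizukiAbsTopIII2015, Rmk 1.5.3 (i) p.33] -/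
theorem intCast_mem_valuationInteger (z : ℤ) : (z : K) ∈ v.integer := by
  rw [Valuation.mem_integer_iff]
  rcases Int.natAbs_eq z with h | h
  · rw [h, Int.cast_natCast]
    exact (v.mem_integer_iff _).mp (natCast_mem_valuationInteger v _)
  · rw [h, Int.cast_neg, Int.cast_natCast, Valuation.map_neg]
    exact (v.mem_integer_iff _).mp (natCast_mem_valuationInteger v _)

/-- A NONTRIVIAL valuation (`v(x) > 1` for some `x`) on a field algebraic over `ℚ` has a residue
characteristic: `v(p) < 1` for some prime number `p`.  (Otherwise every prime, hence every nonzero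
integer and every nonzero rational, is a `v`-unit; then `ℚ` lies in the valuation ring, over which
every element of `K` is integral, so the valuation ring is all of `K`.)  This is "the residue
characteristic `p` of `𝔭`" in [AbsTopIII] Rmk. 1.5.3 (i).
[cite: MochizukiAbsTopIII2015, Rmk 1.5.3 (i) p.33] -/
theorem exists_prime_valuation_lt_one [CharZero K] [Algebra ℚ K] [Algebra.IsAlgebraic ℚ K]
    (hv : ∃ x : K, 1 < v x) : ∃ p : ℕ, p.Prime ∧ v (p : K) < 1 := by
  by_contra hcon
  push Not at hcon
  have hnat : ∀ n : ℕ, n ≠ 0 → v (n : K) = 1 := by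
    intro n
    refine Nat.strong_induction_on n fun n ih hn => ?_
    by_cases hn1 : n = 1
    · subst hn1
      simp
    · obtain ⟨p, hp, m, rfl⟩ := Nat.exists_prime_and_dvd hn1
      have hm0 : m ≠ 0 := fun h => hn (by rw [h, mul_zero])
      have hmlt : m < p * m := by nlinarith [hp.two_le, Nat.pos_of_ne_zero hm0]
      rw [Nat.cast_mul, map_mul, ih m hmlt hm0, mul_one]
      exact le_antisymm ((v.mem_integer_iff _).mp (natCast_mem_valuationInteger v p)) (hcon p hp)
  have hrat : ∀ q : ℚ, v (q : K) ≤ 1 := fun q => by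
    rw [Rat.cast_def, map_div₀, hnat q.den q.den_ne_zero, div_one]
    exact (v.mem_integer_iff _).mp (intCast_mem_valuationInteger v q.num)
  obtain ⟨x, hx⟩ := hv
  let φ : ℚ →+* v.integer :=
    (Rat.castHom K).codRestrict v.integer fun q => (v.mem_integer_iff _).mpr (hrat q)
  have hint : IsIntegral v.integer x := by
    obtain ⟨P, hPm, hPx⟩ := (Algebra.IsAlgebraic.isAlgebraic (R := ℚ) x).isIntegral
    refine ⟨P.map φ, hPm.map φ, ?_⟩
    have hcomp : (algebraMap v.integer K).comp φ = algebraMap ℚ K := by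
      refine RingHom.ext fun q => ?_
      rw [RingHom.comp_apply, eq_ratCast (algebraMap ℚ K) q]
      rfl
    rw [Polynomial.eval₂_map, hcomp]
    exact hPx
  exact (not_le.mpr hx)
    ((v.mem_integer_iff x).mp ((Valuation.integer.integers v).mem_of_integral hint))

/-- If `v(p) < 1` for a prime `p`, then integers prime to `p` are `v`-units (Bezout:
`1 = a·p + b·m`). [cite: MochizukiAbsTopIII2015, Rmk 1.5.3 (i) p.33] -/
theorem valuation_natCast_eq_one_of_not_dvd {p : ℕ} (hp : p.Prime) (hvp : v (p : K) < 1)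
    {m : ℕ} (hm : ¬ p ∣ m) : v (m : K) = 1 := by
  have hcop : Nat.Coprime p m := hp.coprime_iff_not_dvd.mpr hm
  have hbez : ((Nat.gcd p m : ℕ) : ℤ) = p * Nat.gcdA p m + m * Nat.gcdB p m := Nat.gcd_eq_gcd_ab p m
  rw [Nat.Coprime.gcd_eq_one hcop] at hbez
  have hK : (1 : K) = (p : K) * (Nat.gcdA p m : K) + (m : K) * (Nat.gcdB p m : K) := by
    have := congrArg (Int.cast : ℤ → K) hbez
    push_cast at this
    exact this
  refine le_antisymm ((v.mem_integer_iff _).mp (natCast_mem_valuationInteger v m)) (not_lt.mp fun hlt => ?_)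
  have h1 : v ((p : K) * (Nat.gcdA p m : K) + (m : K) * (Nat.gcdB p m : K)) < 1 := by
    refine lt_of_le_of_lt (v.map_add _ _) (max_lt ?_ ?_)
    · rw [map_mul]
      calc v (p : K) * v (Nat.gcdA p m : K) ≤ v (p : K) * 1 :=
            mul_le_mul_right ((v.mem_integer_iff _).mp (intCast_mem_valuationInteger v _)) _
        _ < 1 := by rw [mul_one]; exact hvp
    · rw [map_mul]
      calc v (m : K) * v (Nat.gcdB p m : K) ≤ v (m : K) * 1 :=
            mul_le_mul_right ((v.mem_integer_iff _).mp (intCast_mem_valuationInteger v _)) _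
        _ < 1 := by rw [mul_one]; exact hlt
  rw [← hK, map_one] at h1
  exact lt_irrefl 1 h1

/-- If `v(p) < 1` then `v(n) = v(p)^e` where `p^e ∥ n`, for every positive integer `n`.
[cite: MochizukiAbsTopIII2015, Rmk 1.5.3 (i) p.33] -/
theorem exists_valuation_natCast_eq_pow {p : ℕ} (hp : p.Prime) (hvp : v (p : K) < 1) {n : ℕ}
    (hn : n ≠ 0) : ∃ e : ℕ, v (n : K) = v (p : K) ^ e := by
  obtain ⟨e, m, hm, rfl⟩ := Nat.exists_eq_pow_mul_and_not_dvd hn p hp.ne_one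
  exact ⟨e, by rw [Nat.cast_mul, Nat.cast_pow, map_mul, map_pow,
    valuation_natCast_eq_one_of_not_dvd v hp hvp hm, mul_one]⟩

/-- If `v(p) < 1` for a prime `p`, then `v` is the `p`-adic valuation on `ℚ` up to equivalence:
`v(q) ∈ v(p)^ℤ` for every nonzero rational `q` — the value group of `ℚ` (and, by
`exists_valuation_pow_mul_eq_zpow_of_finiteDimensional`, of every number field, up to a bounded
exponent) is DISCRETE. [cite: MochizukiAbsTopIII2015, Rmk 1.5.3 (i) p.33] -/
theorem exists_valuation_ratCast_eq_zpow [CharZero K] {p : ℕ} (hp : p.Prime)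
    (hvp : v (p : K) < 1) {q : ℚ} (hq : q ≠ 0) : ∃ n : ℤ, v (q : K) = v (p : K) ^ n := by
  have hvp0 : v (p : K) ≠ 0 := (Valuation.ne_zero_iff v).mpr (Nat.cast_ne_zero.mpr hp.ne_zero)
  obtain ⟨a, ha⟩ := exists_valuation_natCast_eq_pow v hp hvp
    (Int.natAbs_ne_zero.mpr (Rat.num_ne_zero.mpr hq))
  obtain ⟨b, hb⟩ := exists_valuation_natCast_eq_pow v hp hvp q.den_ne_zero
  have hnum : v (q.num : K) = v ((q.num.natAbs : ℕ) : K) := by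
    rcases Int.natAbs_eq q.num with h | h
    · conv_lhs => rw [h, Int.cast_natCast]
    · conv_lhs => rw [h, Int.cast_neg, Int.cast_natCast, Valuation.map_neg]
  refine ⟨(a : ℤ) - b, ?_⟩
  rw [Rat.cast_def, map_div₀, hnum, ha, hb, zpow_sub₀ hvp0, zpow_natCast, zpow_natCast]

/-! ### The ultrametric degree bound -/

/-- Ultrametric degree bound: if `x ≠ 0` is a root of a nonzero polynomial `P ∈ K[X]` in a valued
field `(L, w)` over `K`, then `w(x)^r ∈ w(K^×)` for some `1 ≤ r ≤ deg P` — in `Σ cᵢ xⁱ = 0` two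
NONZERO terms must share the maximal valuation.  (So the ramification index of `w` on `K(x)` over
`K` is at most `deg P`: "any finite extension of `k` satisfies the same hypotheses as `k`".)
[cite: MochizukiAbsTopIII2015, Rmk 1.5.3 (i) p.33] -/
theorem exists_pow_valuation_eq_of_aeval_eq_zero {L : Type*} [Field L] [Algebra K L]
    (w : Valuation L Γ₀) {x : L} (hx : x ≠ 0) {P : K[X]} (hP : P ≠ 0) (hPx : aeval x P = 0) :
    ∃ r : ℕ, 0 < r ∧ r ≤ P.natDegree ∧ ∃ c : K, c ≠ 0 ∧ w x ^ r = w (algebraMap K L c) := by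
  by_contra hcon
  push Not at hcon
  set t : ℕ → L := fun i => algebraMap K L (P.coeff i) * x ^ i with ht
  have hx0 : w x ≠ 0 := (Valuation.ne_zero_iff w).mpr hx
  -- two nonzero terms with equal valuation would violate `hcon`
  have key : ∀ i j, i < j → j ≤ P.natDegree → P.coeff i ≠ 0 → P.coeff j ≠ 0 →
      w (t i) = w (t j) → False := by
    intro i j hij hj hi hj' heq
    obtain ⟨d, rfl⟩ := Nat.exists_eq_add_of_lt hij
    have haj : w (algebraMap K L (P.coeff (i + d + 1))) ≠ 0 :=
      (Valuation.ne_zero_iff w).mpr ((_root_.map_ne_zero _).mpr hj')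
    refine hcon (d + 1) d.succ_pos (by omega) (P.coeff i / P.coeff (i + d + 1))
      (div_ne_zero hi hj') ?_
    simp only [ht, map_mul, map_pow] at heq
    have heq' : w (algebraMap K L (P.coeff i)) * w x ^ i =
        (w (algebraMap K L (P.coeff (i + d + 1))) * w x ^ (d + 1)) * w x ^ i := by
      rw [heq, add_assoc, pow_add, mul_assoc, mul_comm (w x ^ i)]
    have hc := mul_right_cancel₀ (pow_ne_zero i hx0) heq'
    rw [map_div₀, map_div₀, eq_div_iff haj, hc, mul_comm]
  set n := P.natDegree with hn
  obtain ⟨i₀, hi₀, hmax⟩ :=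
    Finset.exists_max_image (Finset.range (n + 1)) (fun i => w (t i)) ⟨n, by simp⟩
  have hmax' : ∀ i ∈ Finset.range (n + 1), w (t i) ≤ w (t i₀) := fun i hi => hmax i hi
  have htn : w (t n) ≠ 0 := by
    simp only [ht, map_mul, map_pow]
    refine mul_ne_zero ((Valuation.ne_zero_iff w).mpr ((_root_.map_ne_zero _).mpr ?_))
      (pow_ne_zero _ hx0)
    rw [hn, Polynomial.coeff_natDegree]
    exact Polynomial.leadingCoeff_ne_zero.mpr hP
  have hti₀ : w (t i₀) ≠ 0 := fun h => by
    have h' := hmax' n (by simp)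
    rw [h] at h'
    exact htn (le_antisymm h' zero_le)
  have hci₀ : P.coeff i₀ ≠ 0 := by
    intro h
    apply hti₀
    simp only [ht, h, map_zero, zero_mul]
  have hlt : ∀ i ∈ (Finset.range (n + 1)).erase i₀, w (t i) < w (t i₀) := by
    intro i hi
    obtain ⟨hne, hi'⟩ := Finset.mem_erase.mp hi
    refine lt_of_le_of_ne (hmax' i hi') fun heq => ?_
    by_cases hci : P.coeff i = 0
    · apply hti₀
      rw [← heq]
      simp only [ht, hci, map_zero, zero_mul]
    · rcases lt_or_gt_of_ne hne with h | h
      · exact key i i₀ h (by have := Finset.mem_range.mp hi₀; omega) hci hci₀ heq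
      · exact key i₀ i h (by have := Finset.mem_range.mp hi'; omega) hci₀ hci heq.symm
  have hsum : ∑ i ∈ Finset.range (n + 1), t i = 0 := by
    have h := hPx
    rw [Polynomial.aeval_eq_sum_range] at h
    simpa only [ht, Algebra.smul_def] using h
  have hvsum : w (∑ i ∈ Finset.range (n + 1), t i) = w (t i₀) := by
    rw [← Finset.add_sum_erase _ _ hi₀]
    exact w.map_add_eq_of_lt_left (w.map_sum_lt hti₀ hlt)
  rw [hsum, map_zero] at hvsum
  exact hti₀ hvsum.symm

/-- Weak discreteness climbs finite extensions: if `w(c)^D ∈ γ^ℤ` for all `c ∈ K^×`, then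
`w(x)^{[L:K]!·D} ∈ γ^ℤ` for all `x ∈ L^×` ("any finite extension of `k` satisfies the same
hypotheses as `k`", [AbsTopIII] Rmk. 1.5.3 (i)). [cite: MochizukiAbsTopIII2015, Rmk 1.5.3 (i) p.33] -/
theorem exists_valuation_pow_mul_eq_zpow_of_finiteDimensional {L : Type*} [Field L] [Algebra K L]
    [FiniteDimensional K L] (w : Valuation L Γ₀) {γ : Γ₀} {D : ℕ}
    (hK : ∀ c : K, c ≠ 0 → ∃ n : ℤ, w (algebraMap K L c) ^ D = γ ^ n) {x : L} (hx : x ≠ 0) :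
    ∃ n : ℤ, w x ^ ((Module.finrank K L).factorial * D) = γ ^ n := by
  have hint : IsIntegral K x := IsIntegral.of_finite K x
  obtain ⟨r, hr0, hrle, c, hc0, hrc⟩ :=
    exists_pow_valuation_eq_of_aeval_eq_zero w hx (minpoly.ne_zero hint) (minpoly.aeval K x)
  obtain ⟨e, he⟩ : r ∣ (Module.finrank K L).factorial :=
    Nat.dvd_factorial hr0 (hrle.trans (minpoly.natDegree_le x))
  obtain ⟨n, hn⟩ := hK c hc0
  refine ⟨n * e, ?_⟩
  rw [he, mul_assoc, pow_mul, hrc, mul_comm e D, pow_mul, hn, ← zpow_natCast (γ ^ n) e,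
    ← zpow_mul]

end Literature.NumberTheory.GaloisRepresentations
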